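import Summits.Ventures.PercRepro.RankLevelSetExplicitLin2ArithB2
import Summits.Ventures.PercRepro.RankLevelSetExplicitLin
import Summits.Ventures.PercRepro.RankLevelSetPlaneTenPrime
import Summits.Ventures.PercRepro.RankLevelSetLevelSevenMult4

/-!
# PercRepro — THEOREM P⁗″: C-025 AT EVERY LEVEL `q ≥ 7` FOR EVERY `p ≥ q·2^{q+1} + 1` (p9, S4)

`proofs/SUBCLAIM-S4-p9.md` §S4.2⁗′. THEOREM P⁗′ (`RankLevelSetExplicitLin`) gives `Plin q ≤ 20·q·2^q + 1`. The
three changes here: (1) LOCAL SPARSITY WITH THE CATALOGUE BOUND in BOTH classes — the cover recursion from the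
tree's `f(6) ≤ 39` gives `f(q) ≤ 5·2^{q−3} − 1` on the `e`-free core for every `q ≥ 6`
(`ncard_le_five_two_pow_of_eRk_le_of_free`), so the big-class weight index is `μ_b = min (5·2^{q−3} − q − 1) d` and
the small-class one `μ_s = min (5·2^{q−4} − q) d`; (2) the big class is bounded by LEMMA `T_k` at every `k ≥ 3` and
ONE Vandermonde binomial `C((q+3)d + 2q − 2, q)` (`tail_sum_le_sparse_all`); (3) the weights keep their DECAY
`2^{μ−d}` past the saturation coranks (`poly_main2`). The threshold is

* `c025_lin2_all (q) (hq : 7 ≤ q) : ∀ M [M.Finite] p, P2 q ≤ p → RLS M p q`, `P2 7 = 651` (the ladder row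
  `c025_seven_large_mult4''`), `P2 (q+1) = max (P2 q) (Tq (q+1)) + 1`, closed form `P2_le_Tq_succ : P2 q ≤ Tq q + 1
  = q·2^{q+1} + 1` for `q ≥ 8`: `Tq 8 = 4 096`, `Tq 9 = 9 216`, `Tq 10 = 20 480`, `Tq 11 = 45 056`,
  `Tq 12 = 98 304`, `Tq 20 = 41 943 040` — against THEOREM P⁗′'s `20·q·2^q` (`204 800` at `q = 10`).
Every fact used is a kernel theorem of the cell's tree or Mathlib. Axioms: standard.
-/

open scoped Matroid

namespace PercRepro

namespace ThmN

open Set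

variable {α : Type}

/-- **THE UNIFORM CATALOGUE FLAT BOUND**: on the `e`-free core, every set of rank `≤ q` has `≤ 5·2^{q−3} − 1`
points, for every `q ≥ 6` (the tree's `f(6) ≤ 39` and the cover step `f(k+1) ≤ 2·f(k) + 1`). -/
theorem ncard_le_five_two_pow_of_eRk_le_of_free (M : Matroid α) [M.Finite]
    (hfree : ∀ e ∈ M.E, ∃ A ⊆ M.E \ {e}, e ∉ M.closure A ∧ e ∉ M.closure ((M.E \ {e}) \ A))
    (q : ℕ) (hq : 6 ≤ q) : ∀ X ⊆ M.E, M.eRk X ≤ q → X.ncard ≤ 5 * 2 ^ (q - 3) - 1 := by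
  induction q, hq using Nat.le_induction with
  | base =>
    intro X hX hr
    have := ncard_le_thirtynine_of_eRk_le_six_of_free M hfree hX (by exact_mod_cast hr)
    omega
  | succ q hq ih =>
    intro X hX hr
    have h := ncard_le_two_mul_add_one_of_free M hfree (k := q) (B := 5 * 2 ^ (q - 3) - 1) ih X hX
      (by exact_mod_cast hr)
    have h8 : 8 ≤ 2 ^ (q - 3) := by
      calc 8 = 2 ^ 3 := by norm_num
        _ ≤ 2 ^ (q - 3) := Nat.pow_le_pow_right (by norm_num) (by omega)
    rw [show q + 1 - 3 = q - 3 + 1 by omega, pow_succ]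
    omega

/-- **The `e`-free core at level `q ≥ 8`, bounded corank `q + 1 ≤ d ≤ q + 2^q`, rank `p ≥ Tq q`** — the
multiplicity count with local sparsity (catalogue bound) + the cap in BOTH classes, Lemma T, Lemma T4, LEMMA `T_k`
(the small-class tail and the whole big class), the tail `16·Σ_{j ≤ 2q+2^q} C(n, j) ≤ 2^n`, and `poly_main2`. -/
theorem c025_core_lin2_bounded (q : ℕ) (hq : 8 ≤ q) (M : Matroid α) [M.Finite] (p d : ℕ)
    (hp : Explicit.Tq q ≤ p) (hd1 : q + 1 ≤ d) (hd2 : d ≤ q + 2 ^ q)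
    (hR : M.eRank = (p : ℕ∞)) (hn : M.E.ncard = p + d)
    (hfree : ∀ e ∈ M.E, ∃ A ⊆ M.E \ {e}, e ∉ M.closure A ∧ e ∉ M.closure ((M.E \ {e}) \ A)) :
    RLS M p q := by
  classical
  obtain ⟨-, htail, -, -⟩ := Explicit.Tq_bounds q hq
  have hx := Explicit.le_two_pow_sub_four q (by omega)
  obtain ⟨h8, h16, hq3, h23⟩ := Explicit.two_pow_facts2 q hq
  have hEcard : M.ground_finite.toFinset.card = p + d := by
    rw [← Set.ncard_eq_toFinset_card _ M.ground_finite]; exact hn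
  -- the core is simple: every circuit has `≥ 3` elements
  have hL : ∀ e ∈ M.E, ¬ M.IsLoop e := not_isLoop_of_free M hfree
  have hs : ∀ e ∈ M.E, ∀ f ∈ M.E, e ≠ f → M.eRk {e, f} = 2 := by
    intro e he f hf hef
    have h2 : (2 : ℕ∞) ≤ M.eRk {e, f} :=
      two_le_eRk_of_two_le_ncard_of_free M hfree (pair_subset he hf) (by rw [ncard_pair hef])
    have h3 : M.eRk {e, f} ≤ 2 := by
      have := M.eRk_le_encard {e, f}
      rwa [encard_pair hef] at this
    exact le_antisymm h3 h2
  have hcirc : ∀ C, M.IsCircuit C → 3 ≤ C.encard := three_le_encard_of_circuit M hL hs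
  have hd : M.E.encard = M.eRank + d := by
    rw [hR, ← M.ground_finite.cast_ncard_eq, hn]
    push_cast
    ring
  -- the nullity cap: every `X ⊆ E` has `|X| ≤ r(X) + d`
  have hcap : ∀ X ⊆ M.E, ∀ k : ℕ, M.eRk X ≤ k → X.ncard ≤ k + d := by
    intro X hX k hr
    have h1 := Matroid.encard_le_eRk_add_of_encard_eq hX hd
    have h2 : X.encard ≤ (k : ℕ∞) + d := h1.trans (by gcongr)
    have hfin : X.Finite := M.ground_finite.subset hX
    rw [← hfin.cast_ncard_eq] at h2
    exact_mod_cast h2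
  -- the flat bounds: rank-`≤ q` sets have `≤ f := min (5·2^{q−3} − 1) (q + d)` points, rank-`≤ q−1` sets
  -- `≤ f' := min (5·2^{q−4} − 1) (q − 1 + d)` points (the catalogue bound and the cap)
  set f : ℕ := min (5 * 2 ^ (q - 3) - 1) (q + d) with hfdef
  set f' : ℕ := min (5 * 2 ^ (q - 4) - 1) (q - 1 + d) with hf'def
  have hflat : ∀ X ⊆ M.E, M.eRk X ≤ q → X.ncard ≤ f := by
    intro X hX hr
    exact le_min (ncard_le_five_two_pow_of_eRk_le_of_free M hfree q (by omega) X hX hr) (hcap X hX q hr)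
  have hflat' : ∀ X ⊆ M.E, M.eRk X ≤ ((q - 1 : ℕ) : ℕ∞) → X.ncard ≤ f' := by
    intro X hX hr
    refine le_min ?_ (hcap X hX (q - 1) hr)
    have := ncard_le_five_two_pow_of_eRk_le_of_free M hfree (q - 1) (by omega) X hX hr
    rwa [show q - 1 - 3 = q - 4 by omega] at this
  -- the weight indices: `f' − q + 1 = μs := min (5·2^{q−4} − q) d`, `f − q = μb := min (5·2^{q−3} − q − 1) d`
  set μs : ℕ := min (5 * 2 ^ (q - 4) - q) d with hμsdef
  set μb : ℕ := min (5 * 2 ^ (q - 3) - q - 1) d with hμbdef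
  have hμs : f' - q + 1 = μs := by
    rw [hf'def, hμsdef]
    rcases le_total (5 * 2 ^ (q - 4) - 1) (q - 1 + d) with h | h
    · rw [min_eq_left h, min_eq_left (by omega)]; omega
    · rw [min_eq_right h, min_eq_right (by omega)]; omega
  have hμb : f - q = μb := by
    rw [hfdef, hμbdef]
    rcases le_total (5 * 2 ^ (q - 3) - 1) (q + d) with h | h
    · rw [min_eq_left h, min_eq_left (by omega)]; omega
    · rw [min_eq_right h, min_eq_right (by omega)]; omega
  have hfq : q + 1 ≤ f := by rw [hfdef]; exact le_min (by omega) (by omega)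
  have hf'q : q ≤ f' := by rw [hf'def]; exact le_min (by omega) (by omega)
  have hμsd : μs ≤ d := min_le_right _ _
  -- (U): the multiplicity count
  have hU1 := Matroid.topCount_le_ncard_compl (M := M) hR hd q
  have hsum := Matroid.ncard_eRk_eq_ncard_le_le_sum (M := M) q d
  have hmul := fun m => Matroid.ncard_eRk_eq_ncard_eq_mul_le M q f f' (by omega) hcirc hflat hflat' hd m
  -- the circuit counts: Lemma T, Lemma T4, LEMMA `T_k`
  have hC1 : ∀ L ⊆ M.E, M.eRk L = 2 → L.ncard ≤ 3 :=
    fun L hL' hr => ncard_le_three_of_eRk_two M hs hfree hL' hr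
  have hs3 : 2 * {C | M.IsCircuit C ∧ C.ncard = 3}.ncard ≤ d * (d + 1) := S1.two_mul_ncard_triangles_le M hC1 hd
  have hC1' : ∀ L ⊆ M.E, M.eRk L ≤ 2 → L.ncard ≤ 3 := by
    intro L hL' hr
    have := ncard_add_one_le_two_pow_of_eRk_le M hL hfree 2 L hL' hr
    omega
  have hC2 : ∀ P ⊆ M.E, M.eRk P ≤ 3 → P.ncard ≤ 6 :=
    fun P hP hr => ncard_le_six_of_eRk_le_three_of_free M hfree hP hr
  have hs4 : 3 * {C : Set α | M.IsCircuit C ∧ C.ncard = 4}.ncard ≤ d * (d + 1) * (d + 2) :=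
    S1.three_mul_ncard_four_circuits_le M hC1' hC2 hd
  have hsp : ∀ j : ℕ, ∀ X ⊆ M.E, M.eRk X ≤ j → X.ncard + 1 ≤ 2 ^ j :=
    fun j X hX hr => ncard_add_one_le_two_pow_of_eRk_le M hL hfree j X hX hr
  have hcsT : ∀ k, 1 ≤ k → {C | M.IsCircuit C ∧ C.ncard = k}.ncard ≤ 2 ^ (k - 1) * (d + k - 2).choose (k - 1) :=
    fun k hk => Matroid.ncard_circuits_le_two_pow_mul_choose_of_free M hd hsp k hk
  -- the two class sums, bounded
  set A : ℕ := ∑ k ∈ Finset.Icc 3 (q + 1), {C | M.IsCircuit C ∧ C.ncard = k}.ncard * M.E.ncard.choose (q + 1 - k)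
    with hAdef
  set B : ℕ := ∑ k ∈ Finset.Icc 3 (q + 1), {C | M.IsCircuit C ∧ C.ncard = k}.ncard * ((q + 1) * d).choose (q + 1 - k)
    with hBdef
  have hA : 6 * A ≤ 3 * (d * (d + 1)) * (p + d).choose (q - 2) + 2 * (d * (d + 1) * (d + 2)) * (p + d).choose (q - 3) +
      6 * ((2 * d + 2 * q - 2).choose 4 * (2 * d + 2 * q - 6 + (p + d)).choose (q - 4)) := by
    rw [hAdef, hn, Explicit.sum_Icc_three_split q (by omega), show q + 1 - 3 = q - 2 by omega,
      show q + 1 - 4 = q - 3 by omega]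
    have h5 : ∑ k ∈ Finset.Icc 5 (q + 1), {C | M.IsCircuit C ∧ C.ncard = k}.ncard * (p + d).choose (q + 1 - k) ≤
        (2 * d + 2 * q - 2).choose 4 * (2 * d + 2 * q - 6 + (p + d)).choose (q - 4) := by
      refine (Finset.sum_le_sum (fun k hk => Nat.mul_le_mul_right _ (hcsT k (by rw [Finset.mem_Icc] at hk; omega)))).trans ?_
      exact Explicit.tail_sum_le_sparse q d (p + d) (by omega)
    have e3 : 6 * ({C | M.IsCircuit C ∧ C.ncard = 3}.ncard * (p + d).choose (q - 2)) ≤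
        3 * (d * (d + 1)) * (p + d).choose (q - 2) := by
      calc 6 * ({C | M.IsCircuit C ∧ C.ncard = 3}.ncard * (p + d).choose (q - 2))
          = 3 * ((2 * {C | M.IsCircuit C ∧ C.ncard = 3}.ncard) * (p + d).choose (q - 2)) := by ring
        _ ≤ 3 * ((d * (d + 1)) * (p + d).choose (q - 2)) := Nat.mul_le_mul_left _ (Nat.mul_le_mul_right _ hs3)
        _ = 3 * (d * (d + 1)) * (p + d).choose (q - 2) := by ring
    have e4 : 6 * ({C | M.IsCircuit C ∧ C.ncard = 4}.ncard * (p + d).choose (q - 3)) ≤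
        2 * (d * (d + 1) * (d + 2)) * (p + d).choose (q - 3) := by
      calc 6 * ({C | M.IsCircuit C ∧ C.ncard = 4}.ncard * (p + d).choose (q - 3))
          = 2 * ((3 * {C | M.IsCircuit C ∧ C.ncard = 4}.ncard) * (p + d).choose (q - 3)) := by ring
        _ ≤ 2 * ((d * (d + 1) * (d + 2)) * (p + d).choose (q - 3)) := Nat.mul_le_mul_left _ (Nat.mul_le_mul_right _ hs4)
        _ = 2 * (d * (d + 1) * (d + 2)) * (p + d).choose (q - 3) := by ring
    have e5 := Nat.mul_le_mul_left 6 h5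
    omega
  have hB : B ≤ ((q + 3) * d + 2 * q - 2).choose q := by
    rw [hBdef]
    refine (Finset.sum_le_sum (fun k hk => Nat.mul_le_mul_right _ (hcsT k (by rw [Finset.mem_Icc] at hk; omega)))).trans ?_
    have h := Explicit.tail_sum_le_sparse_all q d ((q + 1) * d)
    have e : 2 * d + 2 * q - 2 + (q + 1) * d = (q + 3) * d + 2 * q - 2 := by
      have : (q + 3) * d = (q + 1) * d + 2 * d := by ring
      omega
    rwa [e] at h
  -- the level counts in `ℚ`, weighted by `1/(m − q)`
  have hlevel : ∀ m ∈ Finset.Icc (q + 1) d, ({X : Set α | X ⊆ M.E ∧ M.eRk X = q ∧ X.ncard = m}.ncard : ℚ) ≤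
      (((f' - q).choose (m - (q + 1)) : ℚ) * (A : ℚ) + ((f - (q + 1)).choose (m - (q + 1)) : ℚ) * (B : ℚ)) /
        ((m - q : ℕ) : ℚ) := by
    intro m hm
    rw [Finset.mem_Icc] at hm
    have hpos : (0 : ℚ) < ((m - q : ℕ) : ℚ) := by exact_mod_cast (by omega : 0 < m - q)
    rw [le_div_iff₀ hpos]
    have h := hmul m
    have h' : (((m - q) * {X : Set α | X ⊆ M.E ∧ M.eRk X = q ∧ X.ncard = m}.ncard : ℕ) : ℚ) ≤
        (((f' - q).choose (m - (q + 1)) * A + (f - (q + 1)).choose (m - (q + 1)) * B : ℕ) : ℚ) := by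
      exact_mod_cast h
    push_cast at h'
    linarith
  have hre : ∑ m ∈ Finset.Icc (q + 1) d,
      (((f' - q).choose (m - (q + 1)) : ℚ) * (A : ℚ) + ((f - (q + 1)).choose (m - (q + 1)) : ℚ) * (B : ℚ)) /
        ((m - q : ℕ) : ℚ) =
      ∑ j ∈ Finset.range (d - q),
      (((f' - q).choose j : ℚ) * (A : ℚ) + ((f - (q + 1)).choose j : ℚ) * (B : ℚ)) / ((j : ℚ) + 1) := by
    rw [show Finset.Icc (q + 1) d = Finset.image (fun j => q + 1 + j) (Finset.range (d - q)) from ?_]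
    · rw [Finset.sum_image (fun a _ b _ h => by omega)]
      apply Finset.sum_congr rfl
      intro j _
      rw [show q + 1 + j - (q + 1) = j by omega, show q + 1 + j - q = j + 1 by omega]
      push_cast
      ring
    · ext m
      rw [Finset.mem_Icc, Finset.mem_image]
      constructor
      · intro hm
        exact ⟨m - (q + 1), by rw [Finset.mem_range]; omega, by omega⟩
      · rintro ⟨j, hj, rfl⟩
        rw [Finset.mem_range] at hj
        omega
  -- the two weights
  set Ws : ℚ := ∑ j ∈ Finset.range (d - q), (((f' - q).choose j : ℕ) : ℚ) / ((j : ℚ) + 1) with hWsdef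
  set Wb : ℚ := ∑ j ∈ Finset.range (d - q), (((f - (q + 1)).choose j : ℕ) : ℚ) / ((j : ℚ) + 1) with hWbdef
  have hUq : (Matroid.topCount M p q : ℚ) ≤ ((p + d).choose q : ℚ) + (Ws * (A : ℚ) + Wb * (B : ℚ)) := by
    have h1 : (Matroid.topCount M p q : ℚ) ≤ ((p + d).choose q : ℚ) +
        ∑ m ∈ Finset.Icc (q + 1) d, ({X : Set α | X ⊆ M.E ∧ M.eRk X = q ∧ X.ncard = m}.ncard : ℚ) := by
      have := hU1.trans hsum
      rw [hn] at this
      exact_mod_cast this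
    have h2 : ∑ m ∈ Finset.Icc (q + 1) d, ({X : Set α | X ⊆ M.E ∧ M.eRk X = q ∧ X.ncard = m}.ncard : ℚ) ≤
        Ws * (A : ℚ) + Wb * (B : ℚ) := by
      rw [hWsdef, hWbdef, Finset.sum_mul, Finset.sum_mul, ← Finset.sum_add_distrib]
      refine (Finset.sum_le_sum hlevel).trans (hre.le.trans ?_)
      apply le_of_eq
      apply Finset.sum_congr rfl
      intro j _
      field_simp
    linarith
  -- the weight bounds: `Ws·μs ≤ 2^{μs}`, `Wb·μb ≤ 2^{μb}` (the closed-form rows)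
  have hWs : Ws * (μs : ℚ) ≤ 2 ^ μs := by
    have h1 := Explicit.sum_range_choose_div_succ_le (f' - q) (d - q)
    rw [← hWsdef] at h1
    have hμq : ((f' - q : ℕ) : ℚ) + 1 = (μs : ℚ) := by exact_mod_cast hμs
    have hμpos : (0 : ℚ) < (μs : ℚ) := by
      have : 1 ≤ μs := by omega
      exact_mod_cast this
    rw [hμq, le_div_iff₀ hμpos] at h1
    have h2 : (2 : ℚ) ^ (f' - q + 1) = 2 ^ μs := by rw [hμs]
    linarith
  have hWb : Wb * (μb : ℚ) ≤ 2 ^ μb := by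
    have h1 := Explicit.sum_range_choose_div_succ_le (f - (q + 1)) (d - q)
    rw [← hWbdef] at h1
    have hμq : ((f - (q + 1) : ℕ) : ℚ) + 1 = (μb : ℚ) := by
      have : f - (q + 1) + 1 = μb := by omega
      exact_mod_cast this
    have hμpos : (0 : ℚ) < (μb : ℚ) := by
      have : 1 ≤ μb := by omega
      exact_mod_cast this
    rw [hμq, le_div_iff₀ hμpos] at h1
    have h2 : (2 : ℚ) ^ (f - (q + 1) + 1) = 2 ^ μb := by rw [show f - (q + 1) + 1 = μb by omega]
    linarith
  -- (Y)
  have hY := Matroid.two_pow_le_midCount_add (M := M) p q hR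
  have hAc : {X : Set α | X ⊆ M.E ∧ M.eRk X ≤ q}.ncard ≤ ∑ j ∈ Finset.range (q + d + 1), (p + d).choose j := by
    calc {X : Set α | X ⊆ M.E ∧ M.eRk X ≤ q}.ncard
        ≤ {X : Set α | X ⊆ (M.ground_finite.toFinset : Set α) ∧ X.ncard ≤ q + d}.ncard := by
          apply ncard_le_ncard
          · intro X hX
            exact ⟨by rw [Set.Finite.coe_toFinset]; exact hX.1, hcap X hX.1 q hX.2⟩
          · exact (Finset.finite_toSet _).finite_subsets.subset (fun X hX => hX.1)
      _ ≤ ∑ j ∈ Finset.range (q + d + 1), M.ground_finite.toFinset.card.choose j :=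
          ncard_subsets_ncard_le _ (q + d)
      _ = ∑ j ∈ Finset.range (q + d + 1), (p + d).choose j := by rw [hEcard]
  have hBc := Matroid.ncard_spanning_le (M := M) hd
  rw [hEcard] at hY hBc
  -- the tail with `K = 2q + 2^q`
  have hT : 16 * ∑ j ∈ Finset.range (2 * q + 2 ^ q + 1), (p + d).choose j ≤ 2 ^ (p + d) :=
    Explicit.sixteen_mul_sum_range_choose_le (2 * q + 2 ^ q) (p + d) (by omega)
  have hA' : ∑ j ∈ Finset.range (q + d + 1), (p + d).choose j ≤
      ∑ j ∈ Finset.range (2 * q + 2 ^ q + 1), (p + d).choose j :=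
    Finset.sum_le_sum_of_subset_of_nonneg (Finset.range_mono (by omega)) (fun _ _ _ => Nat.zero_le _)
  have hB' : ∑ j ∈ Finset.range (d + 1), (p + d).choose j ≤
      ∑ j ∈ Finset.range (2 * q + 2 ^ q + 1), (p + d).choose j :=
    Finset.sum_le_sum_of_subset_of_nonneg (Finset.range_mono (by omega)) (fun _ _ _ => Nat.zero_le _)
  have hAB : 8 * ({X : Set α | X ⊆ M.E ∧ M.eRk X ≤ q}.ncard +
      {X : Set α | X ⊆ M.E ∧ M.eRk X = M.eRank}.ncard) ≤ 2 ^ (p + d) := by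
    have h1 := hAc.trans hA'
    have h2 := hBc.trans hB'
    omega
  -- (Φ) and the polynomial inequality
  have hΦ := phiK_le_two_pow_div p q
  rw [Nat.choose_symm_add] at hΦ
  have hpolyq := Explicit.poly_main2 q d p μs μb hq hd1 hd2 hp rfl rfl A B Ws Wb hWs hWb hA hB
  rw [add_assoc] at hpolyq
  -- assemble in `ℚ`
  rw [RLS_iff]
  have hYq : (2 : ℚ) ^ (p + d) ≤ (Matroid.midCount M p q : ℚ) +
      ({X : Set α | X ⊆ M.E ∧ M.eRk X ≤ q}.ncard : ℚ) +
      ({X : Set α | X ⊆ M.E ∧ M.eRk X = M.eRank}.ncard : ℚ) := by exact_mod_cast hY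
  have hABq : 8 * (({X : Set α | X ⊆ M.E ∧ M.eRk X ≤ q}.ncard : ℚ) +
      ({X : Set α | X ⊆ M.E ∧ M.eRk X = M.eRank}.ncard : ℚ)) ≤ 2 ^ (p + d) := by exact_mod_cast hAB
  have hU0 : (0 : ℚ) ≤ (Matroid.topCount M p q : ℚ) := Nat.cast_nonneg _
  exact level_arith (p := p) (d := d) (n := p + d) (q := q) rfl (by omega) hΦ hU0 hUq hYq hABq hpolyq

/-- **The level step of THEOREM P⁗″**: level `q ≥ 7` for all `p ≥ P` and `P ≥ Tq (q+1)` give level `q + 1` for all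
`p ≥ P + 1` (`rls_succ_large` with `D = q + 1`; the core is `c025_core_lin2_bounded` / `c025_core_explicit_large'` at
level `q + 1 ≥ 8`). -/
theorem c025_succ_lin2 (q : ℕ) (hq : 7 ≤ q) (P : ℕ) (hP : Explicit.Tq (q + 1) ≤ P)
    (hprev : ∀ (M : Matroid α) [M.Finite] (p : ℕ), P ≤ p → q + 2 ≤ p → RLS M p q) :
    ∀ (M : Matroid α) [M.Finite] (p : ℕ), P + 1 ≤ p → RLS M p (q + 1) := by
  intro M _ p hp
  obtain ⟨hN₁, -, -, hq3⟩ := Explicit.Tq_bounds (q + 1) (by omega)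
  refine rls_succ_large (α := α) q (q + 1) P hprev ?_ ?_ M p hp (by omega)
  · -- corank `≤ q + 1`: `U = ∅` or Theorem M
    intro M' _ p' _ hn _
    rcases Nat.lt_or_ge M'.E.ncard (p' + (q + 1)) with h | h
    · exact RLS_of_ncard_lt M' h
    · exact RLS_of_ncard_eq M' (by omega)
  · -- the core at level `q + 1`
    intro M' _ p' hP' hR hbig _ hfree
    rcases Nat.lt_or_ge M'.E.ncard (p' + (q + 1) + 2 ^ (q + 1) + 1) with h | h
    · exact c025_core_lin2_bounded (q + 1) (by omega) M' p' (M'.E.ncard - p') (hP.trans hP')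
        (by omega) (by omega) hR (by omega) hfree
    · exact c025_core_explicit_large' (q + 1) (by omega) M' p' (by omega) hR (by omega) hfree

/-- **THE THRESHOLD SEQUENCE OF THEOREM P⁗″** `P2`: `P2 7 = 651` (the ladder row), and
`P2 (q+1) = max (P2 q) (Tq (q+1)) + 1` for `q ≥ 7`. -/
def P2 : ℕ → ℕ
  | 0 => 651
  | 1 => 651
  | 2 => 651
  | 3 => 651
  | 4 => 651
  | 5 => 651
  | 6 => 651
  | 7 => 651
  | q + 8 => max (P2 (q + 7)) (Explicit.Tq (q + 8)) + 1

/-- The recursion of `P2` at `q ≥ 7`. -/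
theorem P2_succ (q : ℕ) (hq : 7 ≤ q) : P2 (q + 1) = max (P2 q) (Explicit.Tq (q + 1)) + 1 := by
  obtain ⟨k, rfl⟩ : ∃ k, q = k + 7 := ⟨q - 7, by omega⟩
  rfl

/-- **THEOREM P⁗″ — C-025 AT EVERY LEVEL `q ≥ 7` FOR EVERY FINITE MATROID AND EVERY `p ≥ P2 q`**, with the
threshold `P2` of order `q·2^{q+1}` (induction on `q` from the ladder row `c025_seven_large_mult4''` through
`c025_succ_lin2`). -/
theorem c025_lin2_all (q : ℕ) (hq : 7 ≤ q) :
    ∀ (M : Matroid α) [M.Finite] (p : ℕ), P2 q ≤ p → RLS M p q := by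
  induction q, hq using Nat.le_induction with
  | base =>
    intro M _ p hp
    exact c025_seven_large_mult4'' M p hp
  | succ q hq ih =>
    intro M _ p hp
    rw [P2_succ q hq] at hp
    refine c025_succ_lin2 q hq (max (P2 q) (Explicit.Tq (q + 1))) (le_max_right _ _) ?_ M p hp
    intro M' _ p' hP' _
    exact ih M' p' ((le_max_left _ _).trans hP')

/-- THEOREM P⁗″ in the literal `C025` body at `(p, q)`. -/
theorem c025_lin2_all' (q : ℕ) (hq : 7 ≤ q) (M : Matroid α) [M.Finite] (p : ℕ) (hp : P2 q ≤ p) :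
    phiK p q * ({A : Set α | A ⊆ M.E ∧ M.eRk A = (p : ℕ∞) ∧ M.eRk (M.E \ A) = (q : ℕ∞)}.ncard : ℚ) ≤
      ({A : Set α | A ⊆ M.E ∧ (q : ℕ∞) < M.eRk A ∧ M.eRk A < (p : ℕ∞)}.ncard : ℚ) :=
  c025_lin2_all q hq M p hp

/-- **THE CLOSED FORM**: `P2 q ≤ Tq q + 1 = q·2^{q+1} + 1` for every `q ≥ 8`. -/
theorem P2_le_Tq_succ (q : ℕ) (hq : 8 ≤ q) : P2 q ≤ Explicit.Tq q + 1 := by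
  induction q, hq using Nat.le_induction with
  | base =>
    show max (P2 7) (Explicit.Tq 8) + 1 ≤ Explicit.Tq 8 + 1
    have : P2 7 ≤ Explicit.Tq 8 := by
      show 651 ≤ Explicit.Tq 8
      unfold Explicit.Tq; norm_num
    omega
  | succ q hq ih =>
    rw [P2_succ q (by omega)]
    have h := Explicit.Tq_succ_le q
    have : max (P2 q) (Explicit.Tq (q + 1)) ≤ Explicit.Tq (q + 1) := max_le (by omega) le_rfl
    omega

/-- **THE ROWS OF S4 (`q ≥ 7`) WITH THE THRESHOLD `q·2^{q+1}`**: C-025 at level `q` for every `p ≥ q·2^{q+1} + 1`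
(at `q = 7`: `1 793 ≥ 651`). -/
theorem c025_lin2_seven_up (q : ℕ) (hq : 7 ≤ q) (M : Matroid α) [M.Finite] (p : ℕ)
    (hp : q * 2 ^ (q + 1) + 1 ≤ p) : RLS M p q := by
  rcases Nat.lt_or_ge q 8 with h | h
  · have hq7 : q = 7 := by omega
    subst hq7
    exact c025_seven_large_mult4'' M p (by norm_num at hp; omega)
  · exact c025_lin2_all q hq M p ((P2_le_Tq_succ q h).trans hp)

/-- Level `10` for `p ≥ 20 481` by THEOREM P⁗″ (against THEOREM P⁗′'s `204 801`). -/
theorem c025_lin2_ten (M : Matroid α) [M.Finite] (p : ℕ) (hp : 20481 ≤ p) : RLS M p 10 :=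
  c025_lin2_seven_up 10 (by norm_num) M p (by norm_num; omega)

/-- Level `9` for `p ≥ 9 217` by THEOREM P⁗″ (the ladder `3 792` and the partition chain stay sharper at `q = 9`). -/
theorem c025_lin2_nine (M : Matroid α) [M.Finite] (p : ℕ) (hp : 9217 ≤ p) : RLS M p 9 :=
  c025_lin2_seven_up 9 (by norm_num) M p (by norm_num; omega)

end ThmN

end PercRepro
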